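import Summits.CriticalPhenomena.SAWScalingLimit.Theorems.MassRatio.Negative.Domain

/-!
# Crux `MassRatio` (stmt-CriticalPhenomena-8550) — load-bearing hypotheses, part 4: finiteness of mid-edge sets (the crux's finsum is a genuine sum), heights of brick vertices, `x_c < 3/5`, and the `endgame` (an eventual `δ² x^ℓ ≤ C δ^{-3/4} x^{ℓ+N}`, `N ≥ 4n`, `n ≥ 1/(6δ)`, is absurd)

Negative knowledge on the crux `MassRatio` (stmt-CriticalPhenomena-8550, route SAWDefectDecoherence r3),
written by the standing disprover (cdisprove, cycles 1–4). The series `MassRatio/Negative/*` does NOT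
refute the crux (verdict: RESISTS — it is a pure exponent bet, predicted ratio `δ^{-25/48}` against the
cut `δ^{-3/4}`); it proves which hypotheses of the crux are LOAD-BEARING (rows clause, `0 < ρ`,
`δ·mid(b_δ) → b`, exhaustion of compacts: each deleted ⇒ FALSE, by explicit admissible families in the
rectangle `D₀ = (-2,2)×(-1,1)` whose boundary mass at the target edge is starved EXACTLY by a bare
corridor), that the hypothesis frame is satisfiable (`massRatio_frame_nonvacuous`), and that the
`Nonempty`-SAW clause is implied by the others. Mechanism throughout: on a bare root-attached corridor
the self-avoiding walk is unique, so `|Z| = x_c^{length}` exactly, while a staircase walk certifies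
`|Z(e₀)| ≥ x_c^{2 iK + 1}` at a mid-edge `e₀` of the compact `Kbox`; `x_c < 3/5` and Bernoulli finish.
-/

namespace Summit.CriticalPhenomena.SAWScalingLimit.Theorems.MassRatio.Negative

open Literature.Probability.LatticeModels Literature.Probability.RandomPlanarGeometry.SAW
open Literature.Probability.RandomPlanarGeometry
open Summit.CriticalPhenomena.SAWScalingLimit.Theses.SAWDefectDecoherence

/-! ## §E. Common tools: finiteness of mid-edge sets, heights of brick vertices, endgame -/

/-- `neighbors_finite`: common analytic/lattice tool (MassRatio negative series). [folklore] -/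
theorem neighbors_finite (v : HexVertex) : {w | hexGraph.Adj v w}.Finite := by
  refine Set.Finite.subset (Set.toFinite ({bv (row v) (pos v + 1), bv (row v) (pos v - 1),
    bv (row v - 1) (pos v), bv (row v + 1) (pos v)} : Set HexVertex)) ?_
  intro w hw
  simp only [Set.mem_setOf_eq] at hw
  rw [adj_iff] at hw
  have e := bv_row_pos w
  simp only [Set.mem_insert_iff, Set.mem_singleton_iff]
  rcases hw with ⟨h1, h2 | h2⟩ | ⟨h1, h2, -⟩ | ⟨h1, h2, -⟩
  · left; rw [← e, h2, h1]
  · right; left; rw [← e, h2, h1]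
  · right; right; left; rw [← e, h2, h1]
  · right; right; right; rw [← e, h2, h1]

/-- The mid-edges of a finite domain form a finite set (so the crux's `finsum` is a true sum). [folklore] -/
theorem hexDomainMidEdges_finite (Λ : Finset HexVertex) : (hexDomainMidEdges Λ).Finite := by
  have hsub : hexDomainMidEdges Λ ⊆
      ⋃ v ∈ (↑Λ : Set HexVertex), (fun w => s(v, w)) '' {w | hexGraph.Adj v w} := by
    intro e he
    obtain ⟨he, v, hv, hvΛ⟩ := he
    induction e using Sym2.ind with
    | h x y =>
      simp only [Set.mem_iUnion, Set.mem_image, Set.mem_setOf_eq, exists_prop]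
      rw [SimpleGraph.mem_edgeSet] at he
      rcases Sym2.mem_iff.1 hv with rfl | rfl
      · exact ⟨v, hvΛ, y, he, rfl⟩
      · exact ⟨v, hvΛ, x, he.symm, Sym2.eq_swap⟩
  exact Set.Finite.subset (Set.Finite.biUnion (Finset.finite_toSet Λ) fun v _ =>
    (neighbors_finite v).image _) hsub

/-- One nonnegative term is below the `finsum` over a finite set. [folklore] -/
theorem term_le_finsum_mem {E : Set (Sym2 HexVertex)} (hE : E.Finite) {f : Sym2 HexVertex → ℝ}
    (hf : ∀ e, 0 ≤ f e) {e₀ : Sym2 HexVertex} (he₀ : e₀ ∈ E) : f e₀ ≤ ∑ᶠ e ∈ E, f e := by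
  rw [finsum_mem_eq_finite_toFinset_sum f hE]
  exact Finset.single_le_sum (fun e _ => hf e) (hE.mem_toFinset.2 he₀)

/-- `snd_bv_of_even`: common analytic/lattice tool (MassRatio negative series). [folklore] -/
theorem snd_bv_of_even {r p : ℤ} (h : (p - r) % 2 = 0) : (((bv r p).2 : ℕ) : ℝ) = 0 := by
  simp [bv, h]

/-- `snd_bv_of_odd`: common analytic/lattice tool (MassRatio negative series). [folklore] -/
theorem snd_bv_of_odd {r p : ℤ} (h : (p - r) % 2 = 1) : (((bv r p).2 : ℕ) : ℝ) = 1 := by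
  simp [bv, h]

/-- `im_center_bv_even`: common analytic/lattice tool (MassRatio negative series). [folklore] -/
theorem im_center_bv_even {r p : ℤ} (h : (p - r) % 2 = 0) :
    (hexCenter (bv r p)).im = hgt * ((r : ℝ) + 1 / 3) := by
  rw [hexCenter_im, snd_bv_of_even h, row_bv, hgt]; ring

/-- `im_center_bv_odd`: common analytic/lattice tool (MassRatio negative series). [folklore] -/
theorem im_center_bv_odd {r p : ℤ} (h : (p - r) % 2 = 1) :
    (hexCenter (bv r p)).im = hgt * ((r : ℝ) + 2 / 3) := by
  rw [hexCenter_im, snd_bv_of_odd h, row_bv, hgt]; ring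

/-- `re_center_bv`: common analytic/lattice tool (MassRatio negative series). [folklore] -/
theorem re_center_bv (r p : ℤ) : (hexCenter (bv r p)).re = ((p : ℝ) + 1) / 2 := by
  rw [hexCenter_re, pos_bv]

/-- Scaled centre, real part. [folklore] -/
theorem re_scaled (δ : ℝ) (v : HexVertex) :
    ((δ : ℂ) * hexCenter v).re = δ * ((pos v : ℝ) + 1) / 2 := by
  rw [Complex.re_ofReal_mul, hexCenter_re]; ring

/-- `im_scaled`: common analytic/lattice tool (MassRatio negative series). [folklore] -/
theorem im_scaled (δ : ℝ) (v : HexVertex) :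
    ((δ : ℂ) * hexCenter v).im = δ * (hexCenter v).im := by
  rw [Complex.im_ofReal_mul]

/-- `im_scaled_ge`: common analytic/lattice tool (MassRatio negative series). [folklore] -/
theorem im_scaled_ge (δ : ℝ) (hδ : 0 ≤ δ) (v : HexVertex) :
    δ * hgt * ((row v : ℝ) + 1 / 3) ≤ ((δ : ℂ) * hexCenter v).im := by
  rw [im_scaled]
  have := hexCenter_im_ge v
  rw [show Real.sqrt 3 / 2 = hgt from rfl] at this
  nlinarith

/-- `im_scaled_le`: common analytic/lattice tool (MassRatio negative series). [folklore] -/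
theorem im_scaled_le (δ : ℝ) (hδ : 0 ≤ δ) (v : HexVertex) :
    ((δ : ℂ) * hexCenter v).im ≤ δ * hgt * ((row v : ℝ) + 2 / 3) := by
  rw [im_scaled]
  have := hexCenter_im_le v
  rw [show Real.sqrt 3 / 2 = hgt from rfl] at this
  nlinarith

/-- Components of a point of the unit ball about `b = 1 - i`. [folklore] -/
theorem ball_pt1 {z : ℂ} (hz : z ∈ Metric.ball (D₀.pt 1) 1) :
    0 < z.re ∧ z.re < 2 ∧ -2 < z.im ∧ z.im < 0 := by
  rw [Metric.mem_ball, D₀_pt1, Complex.dist_eq] at hz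
  have hre := Complex.abs_re_le_norm (z - ⟨1, -1⟩)
  have him := Complex.abs_im_le_norm (z - ⟨1, -1⟩)
  simp only [Complex.sub_re, Complex.sub_im] at hre him
  rw [abs_le] at hre him
  have h1 : |(z - ⟨1, -1⟩ : ℂ).re| < 1 := lt_of_le_of_lt (Complex.abs_re_le_norm _) hz
  have h2 : |(z - ⟨1, -1⟩ : ℂ).im| < 1 := lt_of_le_of_lt (Complex.abs_im_le_norm _) hz
  simp only [Complex.sub_re, Complex.sub_im] at h1 h2
  rw [abs_lt] at h1 h2
  refine ⟨by linarith, by linarith, by linarith, by linarith⟩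

/-- `x_c < 3/5`. [folklore] -/
theorem xc_lt : hexCriticalFugacity < 3 / 5 := by
  have h := hexCriticalFugacity_sq
  have h0 := hexCriticalFugacity_pos_lt_one.1
  have hs : (1 : ℝ) < Real.sqrt 2 := by
    rw [show (1:ℝ) = Real.sqrt 1 by simp]
    exact Real.sqrt_lt_sqrt (by norm_num) (by norm_num)
  nlinarith

/-- Bernoulli: `x^n ≤ 3/(2n)` for `0 < x ≤ 3/5` and `n ≥ 1`. [folklore] -/
theorem pow_le_of_bernoulli {x : ℝ} (hx0 : 0 < x) (hx1 : x ≤ 3 / 5) (n : ℕ) (hn : 1 ≤ n) :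
    x ^ n ≤ 3 / (2 * n) := by
  have hinv : 2 / 3 ≤ 1 / x - 1 := by
    have : 5 / 3 ≤ 1 / x := by
      rw [le_div_iff₀ hx0]; linarith
    linarith
  have hb := one_add_mul_le_pow (a := 1 / x - 1) (by linarith) n
  have hxn : (1 / x) ^ n = 1 / x ^ n := by rw [one_div_pow]
  rw [show 1 + (1 / x - 1) = 1 / x by ring, hxn] at hb
  have hn' : (1:ℝ) ≤ n := by exact_mod_cast hn
  have hpos : 0 < x ^ n := pow_pos hx0 n
  rw [le_div_iff₀ (by positivity)]
  have : (n : ℝ) * (2 / 3) ≤ 1 / x ^ n := by nlinarith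
  rw [le_div_iff₀ hpos] at this
  nlinarith

/-- **Endgame.** An eventual inequality `δ² x^ℓ ≤ C δ^{-3/4} x^{ℓ+N}` with `N ≥ 4n`,
`n ≥ 1/(6δ)` is impossible: the right-hand side is `O(δ^{-3/4}·δ⁴)`. [folklore] -/
theorem endgame {x : ℝ} (hx0 : 0 < x) (hx1 : x ≤ 3 / 5) (C : ℝ) (ℓ N n : ℝ → ℕ)
    (hev : ∀ᶠ δ in nhdsWithin 0 (Set.Ioi 0),
      δ ^ 2 * x ^ (ℓ δ) ≤ C * δ ^ (-(3:ℝ) / 4) * x ^ (ℓ δ + N δ))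
    (hN : ∀ᶠ δ in nhdsWithin 0 (Set.Ioi 0), 4 * n δ ≤ N δ ∧ 1 / (6 * δ) ≤ (n δ : ℝ)) : False := by
  set ε₀ : ℝ := min 1 (1 / (6561 * |C| + 1)) with hε₀
  have hε₀pos : 0 < ε₀ := lt_min one_pos (by positivity)
  have hsmall : ∀ᶠ δ in nhdsWithin 0 (Set.Ioi 0), 0 < δ ∧ δ < ε₀ := by
    filter_upwards [Ioo_mem_nhdsGT hε₀pos] with δ hδ using ⟨hδ.1, hδ.2⟩
  obtain ⟨δ, ⟨hδ0, hδε⟩, hineq, hNn, hn⟩ := (hsmall.and (hev.and hN)).exists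
  have hδ1 : δ ≤ 1 := le_trans hδε.le (min_le_left _ _)
  have hx1' : x ≤ 1 := by linarith
  -- positivity of the left-hand side
  have hL : 0 < δ ^ 2 * x ^ (ℓ δ) := by positivity
  -- the sign of `C`
  have hrpow_pos : 0 < δ ^ (-(3:ℝ) / 4) := Real.rpow_pos_of_pos hδ0 _
  by_cases hC' : C < 0
  · have : C * δ ^ (-(3:ℝ) / 4) * x ^ (ℓ δ + N δ) < 0 := by
      have h1 : C * δ ^ (-(3:ℝ) / 4) < 0 := mul_neg_of_neg_of_pos hC' hrpow_pos
      exact mul_neg_of_neg_of_pos h1 (by positivity)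
    linarith
  have hC : 0 ≤ C := not_lt.1 hC'
  -- `δ^{-3/4} ≤ δ⁻¹`
  have hrpow : δ ^ (-(3:ℝ) / 4) ≤ δ⁻¹ := by
    rw [← Real.rpow_neg_one]
    exact Real.rpow_le_rpow_of_exponent_ge hδ0 hδ1 (by norm_num)
  -- `x^N ≤ (x^n)^4 ≤ (9δ)^4`
  have hn1 : 1 ≤ n δ := by
    have : (0:ℝ) < n δ := lt_of_lt_of_le (by positivity) hn
    exact_mod_cast this
  have hxn : x ^ (n δ) ≤ 9 * δ := by
    have h := pow_le_of_bernoulli hx0 hx1 (n δ) hn1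
    have hnpos : (0:ℝ) < n δ := by exact_mod_cast hn1
    calc x ^ (n δ) ≤ 3 / (2 * n δ) := h
      _ ≤ 3 / (2 * (1 / (6 * δ))) := by
        apply div_le_div_of_nonneg_left (by norm_num) (by positivity)
        nlinarith
      _ = 9 * δ := by field_simp; ring
  have hxN : x ^ (N δ) ≤ (9 * δ) ^ 4 := by
    calc x ^ (N δ) ≤ x ^ (4 * n δ) := pow_le_pow_of_le_one hx0.le hx1' hNn
      _ = (x ^ (n δ)) ^ 4 := by rw [pow_mul']
      _ ≤ (9 * δ) ^ 4 := pow_le_pow_left₀ (by positivity) hxn 4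
  -- combine
  have key : δ ^ 2 * x ^ (ℓ δ) ≤ C * δ⁻¹ * (x ^ (ℓ δ) * (9 * δ) ^ 4) := by
    calc δ ^ 2 * x ^ (ℓ δ) ≤ C * δ ^ (-(3:ℝ) / 4) * x ^ (ℓ δ + N δ) := hineq
      _ = C * δ ^ (-(3:ℝ) / 4) * (x ^ (ℓ δ) * x ^ (N δ)) := by rw [pow_add]
      _ ≤ C * δ⁻¹ * (x ^ (ℓ δ) * (9 * δ) ^ 4) := by
        apply mul_le_mul (mul_le_mul_of_nonneg_left hrpow hC) _ (by positivity) (by positivity)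
        exact mul_le_mul_of_nonneg_left hxN (by positivity)
  -- divide by `x^ℓ δ²`: `1 ≤ 6561 C δ`
  have hxl : 0 < x ^ (ℓ δ) := by positivity
  have key2 : δ ^ 2 ≤ C * δ⁻¹ * (9 * δ) ^ 4 := by
    have key' : δ ^ 2 * x ^ (ℓ δ) ≤ C * δ⁻¹ * (9 * δ) ^ 4 * x ^ (ℓ δ) := by
      calc δ ^ 2 * x ^ (ℓ δ) ≤ C * δ⁻¹ * (x ^ (ℓ δ) * (9 * δ) ^ 4) := key
        _ = C * δ⁻¹ * (9 * δ) ^ 4 * x ^ (ℓ δ) := by ring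
    exact le_of_mul_le_mul_right key' hxl
  have key3 : 1 ≤ 6561 * C * δ := by
    have h9 : C * δ⁻¹ * (9 * δ) ^ 4 = 6561 * C * δ * δ ^ 2 := by field_simp; ring
    rw [h9] at key2
    have hδ2 : 0 < δ ^ 2 := by positivity
    by_contra hcon
    have hcon' : 6561 * C * δ < 1 := not_le.1 hcon
    nlinarith
  -- but `δ < 1/(6561 |C| + 1)`
  have hδs : δ < 1 / (6561 * |C| + 1) := lt_of_lt_of_le hδε (min_le_right _ _)
  rw [abs_of_nonneg hC] at hδs
  rw [lt_div_iff₀ (by positivity)] at hδs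
  nlinarith

/-- `mid_re`: common analytic/lattice tool (MassRatio negative series). [folklore] -/
theorem mid_re (u v : HexVertex) : (hexMidpoint s(u, v)).re = ((pos u : ℝ) + pos v + 2) / 4 := by
  rw [hexMidpoint_mk, Complex.div_ofNat_re, Complex.add_re, hexCenter_re, hexCenter_re]; ring

/-- `mid_im`: common analytic/lattice tool (MassRatio negative series). [folklore] -/
theorem mid_im (u v : HexVertex) :
    (hexMidpoint s(u, v)).im = ((hexCenter u).im + (hexCenter v).im) / 2 := by
  rw [hexMidpoint_mk, Complex.div_ofNat_im, Complex.add_im]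

/-- A compact subset of the open rectangle keeps a positive distance from its sides. [folklore] -/
theorem compact_box {K : Set ℂ} (hK : IsCompact K) (hKD : K ⊆ D₀.carrier) :
    ∃ ε > 0, ∀ z ∈ K, (-2 + ε < z.re ∧ z.re < 2 - ε) ∧ (-1 + ε < z.im ∧ z.im < 1 - ε) := by
  obtain ⟨ε, hε, hsub⟩ := hK.exists_cthickening_subset_open D₀.isOpen hKD
  refine ⟨ε, hε, fun z hz => ?_⟩
  have h1 : ∀ w : ℂ, ‖w‖ ≤ ε → z + w ∈ D₀.carrier := fun w hw =>
    hsub (Metric.mem_cthickening_of_dist_le (z + w) z ε K hz (by simpa [dist_eq_norm] using hw))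
  have e1 := (mem_D₀_carrier.1 (h1 (ε : ℂ) (by simp [abs_of_pos hε])))
  have e2 := (mem_D₀_carrier.1 (h1 (-(ε : ℂ)) (by simp [abs_of_pos hε])))
  have e3 := (mem_D₀_carrier.1 (h1 ((ε : ℂ) * Complex.I) (by simp [abs_of_pos hε])))
  have e4 := (mem_D₀_carrier.1 (h1 (-((ε : ℂ) * Complex.I)) (by simp [abs_of_pos hε])))
  simp only [Complex.add_re, Complex.add_im, Complex.ofReal_re, Complex.ofReal_im, Complex.neg_re,
    Complex.neg_im, Complex.mul_re, Complex.mul_im, Complex.I_re, Complex.I_im] at e1 e2 e3 e4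
  refine ⟨⟨by linarith [e2.1.1], by linarith [e1.1.2]⟩, by linarith [e4.2.1], by linarith [e3.2.2]⟩

end Summit.CriticalPhenomena.SAWScalingLimit.Theorems.MassRatio.Negative
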